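import Literature.NumberTheory.Automorphic.UnitaryTwoUnipotentClasses              -- ★ p08 (g17): `n(t)` on `K²`, transitivity, `exists_conj_lineUnipotent_eq_iff_exists_norm_mul`
import Literature.LinearAlgebra.Matrix.FiniteFieldHermitianCongruence              -- ★ `exists_formCongr_one_eq`; brings ★ `HermitianSphereCount` (`natCard_norm_eq`, `natCard_sphere_succ_zero`)
import HarnessLib

/-!
# The unipotents of `U₂(𝔽_q) = U(1,1)(𝔽_q)`: ONE non-trivial class, each fixing exactly ONE isotropic line; `(q²−1)(q+1)` non-zero isotropic vectors
# (Wilson, *The Finite Simple Groups*, §3.6 (3.25), §3.6.1; Rogawski 1990, §1.9, §3.9)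

Topic `Literature/GroupTheory/SpecificGroups`; namespace `Literature.GroupTheory.SpecificGroups`. THEOREMS ONLY (no definition, no named fact, no instance, no notation,
no `sorry`).  Road «S3-tree» of cell `pub/hodgecm-mathlib` (crux H413 = `stmt-HodgeConjecture-24833`): the rank-2 twin of ★ `FiniteUnitaryThreeUnipotentJordanClasses` ∕
★ `UnitaryThreeUnipotentFixedIsotropicUnique` (F0P3-p03 (g13)), for the RESIDUAL PLANE of a type-2 vertex of the `U(3)` tree and for the `H`-side factor `U(W) = U(1,1)` (T2-E′
dictionary A-63 «residually unipotent ⇒ 1 fixed point»; the `χ₁`-stratum `rank(h̄_W − 1) = 1` of the T3′ head).  Currency = ★ p08 `UnitaryTwoUnipotentClasses` (`unitaryGroupOfForm σ J₀`,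
`J₀ = (StdForm.antidiagonal 2).over K`, `n(t) = (1,t;0,1)`, classes `t mod N E^×` over any field); here: uniqueness of the fixed line (any field), ONE class over `𝔽_{q²}` (the norm is
onto), transport to any non-degenerate hermitian plane, and the isotropic census of the plane.  HONEST LABEL: HC_CM is proved only modulo the printed citations (the 2 remaining named
inputs hLiu418, h413) until rung 0 closes; elementary and asserts nothing printed about the `p`-adic groups.

THE PRINT. [Wilson2009, §3.6.1 p. 67]: «`PSU_2(q) ≅ PSL_2(q)` … The unitary transvections for fixed `v` form an abelian normal subgroup of the stabiliser of `⟨v⟩`»; [Wilson2009, §3.6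
(3.25) p. 66]: `z₂ = (q²−1)(q+1)`, i.e. `q + 1` isotropic points of the hermitian line; [Rogawski1990, §3.9 p. 32]: «the conjugacy class of `n(t)` is determined by `t mod NE^*`» (read on
`U(Φ₂)`, §1.9) — over a finite field `NE^* = F^*`, so ONE class.

* §1 (any field, `σ` involution) **`exists_smul_of_fixed_two`** — a unipotent `u ≠ 1` of `U(σ, J₀)` on `K²` fixes exactly one line: `u v = v ≠ 0`, `u w = w ⇒ w ∈ K·v`;
  **`exists_conj_eq_of_ne_one_two_of_norm_surjective`** — two unipotents `≠ 1` are conjugate as soon as every non-zero fixed element is a norm.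
* §2 (`k = 𝔽_{q²}`) **`exists_conj_eq_of_ne_one_two`**, **`eq_of_conj_invariant_of_ne_one_two`**; transport **`…_of_hermitian`** to any non-degenerate `σ`-hermitian `J ∈ M₂(k)`.
* §3 **`natCard_isotropic_antidiag_two`** (`#{v ∈ k² : B₀ v v = 0} = q³ + q² − q`), **`natCard_isotropic_ne_zero_antidiag_two`** (`= (q²−1)(q+1)`).

## References
* [Wilson2009] R. A. Wilson, *The Finite Simple Groups*, GTM 251 (2009): §3.6 (3.25) p. 66; §3.6.1 p. 67.
* [Rogawski1990] J. D. Rogawski, *Automorphic Representations of Unitary Groups in Three Variables* (1990): §1.9 pp. 8–9 (`U(2)`, `Φ₂`), §3.9 p. 32.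
-/

set_option autoImplicit false

noncomputable section

open Finset Matrix Literature.FieldTheory.FiniteFields Literature.NumberTheory.Automorphic
open Literature.NumberTheory.Automorphic.HermitianLattice Literature.NumberTheory.Automorphic.UnitaryGroup Literature.LinearAlgebra.Matrix

namespace Literature.GroupTheory.SpecificGroups

/-! ### §1 Any field: the unique fixed line; one class modulo norms -/

section AnyField

variable {K : Type*} [Field K] (σ : K →+* K)

/-- A conjugate `k u k⁻¹ = n(0) = 1` forces `u = 1`. [cite: Rogawski1990, §3.9 p. 32] -/
theorem eq_one_of_conj_coe_eq_lineUnipotent_zero {k u : GL (Fin 2) K}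
    (h : ((k * u * k⁻¹ : GL (Fin 2) K) : Matrix (Fin 2) (Fin 2) K) = !![1, (0 : K); 0, 1]) : u = 1 := by
  have h1 : k * u * k⁻¹ = 1 := by
    ext i j
    rw [h, Units.val_one]
    fin_cases i <;> fin_cases j <;> simp
  calc u = k⁻¹ * (k * u * k⁻¹) * k := by group
    _ = 1 := by rw [h1]; group

/-- **A unipotent `u ≠ 1` of `U(σ, J₀)` on `K²` fixes exactly ONE line**: if `u v = v` with `v ≠ 0` isotropic and `u w = w`, then `w ∈ K·v` (move `v` to `e₀` by ★ transitivity; then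
`k⁻¹uk = n(t)`, `t ≠ 0`, and `n(t) w′ = w′` forces `w′₁ = 0`). [cite: Wilson2009, §3.6.1 p. 67] [cite: Rogawski1990, §3.9 p. 32] -/
theorem exists_smul_of_fixed_two (hσ : ∀ z : K, σ (σ z) = z) {u : GL (Fin 2) K}
    (hu : u ∈ unitaryGroupOfForm σ ((StdForm.antidiagonal 2).over K)) (hnil : IsNilpotent ((u : Matrix (Fin 2) (Fin 2) K) - 1)) (h1 : u ≠ 1)
    {v w : Fin 2 → K} (hv : v ≠ 0) (hviso : B₀ σ 2 v v = 0) (hvfix : (u : Matrix (Fin 2) (Fin 2) K) *ᵥ v = v)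
    (hwfix : (u : Matrix (Fin 2) (Fin 2) K) *ᵥ w = w) : ∃ c : K, w = c • v := by
  obtain ⟨g, hg, hge⟩ := exists_mem_unitaryGroupOfForm_mulVec_single_eq_two σ hσ hv hviso
  have hgg : ((g⁻¹ : GL (Fin 2) K) : Matrix (Fin 2) (Fin 2) K) * (g : Matrix (Fin 2) (Fin 2) K) = 1 := by
    rw [← Units.val_mul, inv_mul_cancel, Units.val_one]
  have hgg' : (g : Matrix (Fin 2) (Fin 2) K) * ((g⁻¹ : GL (Fin 2) K) : Matrix (Fin 2) (Fin 2) K) = 1 := by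
    rw [← Units.val_mul, mul_inv_cancel, Units.val_one]
  set u' : GL (Fin 2) K := g⁻¹ * u * g with hu'def
  have hu' : u' ∈ unitaryGroupOfForm σ ((StdForm.antidiagonal 2).over K) :=
    Subgroup.mul_mem _ (Subgroup.mul_mem _ (Subgroup.inv_mem _ hg) hu) hg
  have hnil' : IsNilpotent ((u' : Matrix (Fin 2) (Fin 2) K) - 1) := by
    have := isNilpotent_coe_conj_sub_one g⁻¹ hnil
    rwa [inv_inv] at this
  -- fixed vectors transport: `u' x = x` iff `u (g x) = g x`
  have hfix : ∀ x : Fin 2 → K, (u : Matrix (Fin 2) (Fin 2) K) *ᵥ ((g : Matrix (Fin 2) (Fin 2) K) *ᵥ x) = (g : Matrix (Fin 2) (Fin 2) K) *ᵥ x →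
      (u' : Matrix (Fin 2) (Fin 2) K) *ᵥ x = x := by
    intro x hx
    rw [hu'def, Units.val_mul, Units.val_mul, ← Matrix.mulVec_mulVec, ← Matrix.mulVec_mulVec, hx, Matrix.mulVec_mulVec, hgg, Matrix.one_mulVec]
  have he' : (u' : Matrix (Fin 2) (Fin 2) K) *ᵥ Pi.single 0 1 = (1 : K) • Pi.single 0 1 := by
    rw [one_smul]; exact hfix _ (by rw [hge, hvfix])
  obtain ⟨t, hmat⟩ := exists_coe_eq_lineUnipotent_of_mulVec_single σ hu' he' hnil'
  have ht0 : t ≠ 0 := by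
    intro h0; rw [h0] at hmat; exact h1 (eq_one_of_conj_coe_eq_lineUnipotent_zero (k := g⁻¹) (by rw [inv_inv]; exact hmat))
  set w' : Fin 2 → K := ((g⁻¹ : GL (Fin 2) K) : Matrix (Fin 2) (Fin 2) K) *ᵥ w with hw'def
  have hgw' : (g : Matrix (Fin 2) (Fin 2) K) *ᵥ w' = w := by rw [hw'def, Matrix.mulVec_mulVec, hgg', Matrix.one_mulVec]
  have hw'fix : (u' : Matrix (Fin 2) (Fin 2) K) *ᵥ w' = w' := hfix _ (by rw [hgw', hwfix])
  rw [hmat] at hw'fix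
  have h0 := (lineUnipotent_mulVec t w').1
  have e0 : t * w' 1 = 0 := by have := congrFun hw'fix 0; rw [h0] at this; linear_combination this
  have hw1 : w' 1 = 0 := by rcases mul_eq_zero.1 e0 with h | h; exact absurd h ht0; exact h
  refine ⟨w' 0, ?_⟩
  rw [← hgw', ← hge, ← Matrix.mulVec_smul]
  congr 1
  funext i
  fin_cases i
  · simp
  · simp [hw1]

/-- **Two unipotents `≠ 1` of `U(σ, J₀)` on `K²` are conjugate when every non-zero fixed element is a norm `σz·z`** («the class of `n(t)` is `t mod NE^*`»).
[cite: Rogawski1990, §3.9 p. 32] [cite: Wilson2009, §3.6.1 p. 67] -/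
theorem exists_conj_eq_of_ne_one_two_of_norm_surjective (hσ : ∀ z : K, σ (σ z) = z)
    (hnorm : ∀ e : K, σ e = e → e ≠ 0 → ∃ z : K, σ z * z = e)
    {u u' : GL (Fin 2) K} (hu : u ∈ unitaryGroupOfForm σ ((StdForm.antidiagonal 2).over K))
    (hu' : u' ∈ unitaryGroupOfForm σ ((StdForm.antidiagonal 2).over K))
    (hnil : IsNilpotent ((u : Matrix (Fin 2) (Fin 2) K) - 1)) (hnil' : IsNilpotent ((u' : Matrix (Fin 2) (Fin 2) K) - 1)) (h1 : u ≠ 1) (h1' : u' ≠ 1) :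
    ∃ g : GL (Fin 2) K, g ∈ unitaryGroupOfForm σ ((StdForm.antidiagonal 2).over K) ∧ g * u * g⁻¹ = u' := by
  obtain ⟨k, hk, t, ht, hkt⟩ := exists_conj_coe_eq_lineUnipotent σ hσ hu hnil
  obtain ⟨k', hk', t', ht', hkt'⟩ := exists_conj_coe_eq_lineUnipotent σ hσ hu' hnil'
  have ht0 : t ≠ 0 := by intro h0; rw [h0] at hkt; exact h1 (eq_one_of_conj_coe_eq_lineUnipotent_zero hkt)
  have ht0' : t' ≠ 0 := by intro h0; rw [h0] at hkt'; exact h1' (eq_one_of_conj_coe_eq_lineUnipotent_zero hkt')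
  have hσt : σ t = -t := by linear_combination ht
  have hσt' : σ t' = -t' := by linear_combination ht'
  have he : σ (t' / t) = t' / t := by rw [map_div₀, hσt, hσt', neg_div_neg_eq]
  obtain ⟨z, hz⟩ := hnorm _ he (div_ne_zero ht0' ht0)
  have hz0 : z ≠ 0 := by rintro rfl; rw [map_zero, zero_mul] at hz; exact div_ne_zero ht0' ht0 hz.symm
  have ht't : t' = z * σ z * t := by rw [mul_comm z, hz]; field_simp
  obtain ⟨k₂, hk₂, hconj⟩ := (exists_conj_lineUnipotent_eq_iff_exists_norm_mul σ hσ ht0 hkt hkt').2 ⟨z, hz0, ht't⟩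
  refine ⟨k'⁻¹ * k₂ * k, Subgroup.mul_mem _ (Subgroup.mul_mem _ (Subgroup.inv_mem _ hk') hk₂) hk, ?_⟩
  calc k'⁻¹ * k₂ * k * u * (k'⁻¹ * k₂ * k)⁻¹ = k'⁻¹ * (k₂ * (k * u * k⁻¹) * k₂⁻¹) * k' := by group
    _ = k'⁻¹ * (k' * u' * k'⁻¹) * k' := by rw [hconj]
    _ = u' := by group

/-- `formCongr` is multiplicative in the change of basis (`2 × 2`). [cite: Wilson2009, §3.6 p. 66] -/
theorem formCongr_mul_two (S T : GL (Fin 2) K) (H : Matrix (Fin 2) (Fin 2) K) :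
    formCongr σ (S * T) H = formCongr σ T (formCongr σ S H) := by
  simp only [formCongr, Units.val_mul, Matrix.map_mul, Matrix.transpose_mul, Matrix.mul_assoc]

end AnyField

/-! ### §2 Over `𝔽_{q²}`: ONE class of non-trivial unipotents in `U₂(𝔽_q)` -/

section Finite

variable {k : Type*} [Field k] [Fintype k] {q : ℕ}

/-- **ONE class**: in `U(σ, J₀)` on `k²` (`#k = q²`, `σ = Frob_q`) any two unipotents `≠ 1` are conjugate (every non-zero fixed element is a norm, ★ `natCard_norm_eq`).
[cite: Rogawski1990, §3.9 p. 32] [cite: Wilson2009, §3.6.1 p. 67] -/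
theorem exists_conj_eq_of_ne_one_two (hk : Fintype.card k = q ^ 2) (σ : k →+* k) (hσ : ∀ x, σ x = x ^ q)
    {u u' : GL (Fin 2) k} (hu : u ∈ unitaryGroupOfForm σ ((StdForm.antidiagonal 2).over k))
    (hu' : u' ∈ unitaryGroupOfForm σ ((StdForm.antidiagonal 2).over k))
    (hnil : IsNilpotent ((u : Matrix (Fin 2) (Fin 2) k) - 1)) (hnil' : IsNilpotent ((u' : Matrix (Fin 2) (Fin 2) k) - 1)) (h1 : u ≠ 1) (h1' : u' ≠ 1) :
    ∃ g : GL (Fin 2) k, g ∈ unitaryGroupOfForm σ ((StdForm.antidiagonal 2).over k) ∧ g * u * g⁻¹ = u' := by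
  refine exists_conj_eq_of_ne_one_two_of_norm_surjective σ (frob_frob hk σ hσ) (fun e he he0 => ?_) hu hu' hnil hnil' h1 h1'
  have h := natCard_norm_eq hk σ hσ he he0
  obtain ⟨⟨x⟩, -⟩ := Nat.card_pos_iff.1 (by rw [h]; exact Nat.succ_pos q : 0 < Nat.card {x : k // σ x * x = e})
  exact ⟨x.1, x.2⟩

/-- **A class function of `U₂(𝔽_q)` is constant on the non-trivial unipotents.** [cite: Rogawski1990, §3.9 p. 32] -/
theorem eq_of_conj_invariant_of_ne_one_two (hk : Fintype.card k = q ^ 2) (σ : k →+* k) (hσ : ∀ x, σ x = x ^ q)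
    {α : Type*} (f : GL (Fin 2) k → α)
    (hf : ∀ g ∈ unitaryGroupOfForm σ ((StdForm.antidiagonal 2).over k), ∀ x ∈ unitaryGroupOfForm σ ((StdForm.antidiagonal 2).over k), f (g * x * g⁻¹) = f x)
    {u u' : GL (Fin 2) k} (hu : u ∈ unitaryGroupOfForm σ ((StdForm.antidiagonal 2).over k))
    (hu' : u' ∈ unitaryGroupOfForm σ ((StdForm.antidiagonal 2).over k))
    (hnil : IsNilpotent ((u : Matrix (Fin 2) (Fin 2) k) - 1)) (hnil' : IsNilpotent ((u' : Matrix (Fin 2) (Fin 2) k) - 1)) (h1 : u ≠ 1) (h1' : u' ≠ 1) :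
    f u = f u' := by
  obtain ⟨g, hg, hconj⟩ := exists_conj_eq_of_ne_one_two hk σ hσ hu hu' hnil hnil' h1 h1'
  rw [← hconj, hf g hg u hu]

/-- Every non-degenerate `σ`-hermitian `J ∈ M₂(𝔽_{q²})` is congruent to the split form `J₀`: `∃ T, σ(T)ᵀ J₀ T = J`. [cite: Wilson2009, §3.4.5 p. 57, §3.6 (3.25) p. 66] -/
theorem exists_formCongr_antidiag_eq_two (hk : Fintype.card k = q ^ 2) (σ : k →+* k) (hσ : ∀ x, σ x = x ^ q)
    (J : Matrix (Fin 2) (Fin 2) k) (hJ : (J.map σ)ᵀ = J) (hdet : J.det ≠ 0) :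
    ∃ T : GL (Fin 2) k, formCongr σ T ((StdForm.antidiagonal 2).over k) = J := by
  have hH : (((StdForm.antidiagonal 2).over k).map σ)ᵀ = (StdForm.antidiagonal 2).over k := by rw [StdForm.over_map, StdForm.transpose_over]
  have hHd : ((StdForm.antidiagonal 2).over k).det ≠ 0 := ((Matrix.isUnit_iff_isUnit_det _).1 ((StdForm.antidiagonal 2).isUnit_over k)).ne_zero
  obtain ⟨T₀, hT₀⟩ := exists_formCongr_one_eq hk σ hσ ((StdForm.antidiagonal 2).over k) hH hHd
  obtain ⟨T₁, hT₁⟩ := exists_formCongr_one_eq hk σ hσ J hJ hdet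
  exact ⟨T₀⁻¹ * T₁, by rw [formCongr_mul_two, ← hT₀, formCongr_inv_formCongr, hT₁]⟩

/-- **ONE class for any form**: in `U(σ, J)`, `J ∈ M₂(𝔽_{q²})` non-degenerate hermitian, any two unipotents `≠ 1` are `U(σ, J)`-conjugate (transport along `σ(T)ᵀ J₀ T = J`).
[cite: Rogawski1990, §1.9 p. 8, §3.9 p. 32] -/
theorem exists_conj_eq_of_ne_one_two_of_hermitian (hk : Fintype.card k = q ^ 2) (σ : k →+* k) (hσ : ∀ x, σ x = x ^ q)
    {J : Matrix (Fin 2) (Fin 2) k} (hJ : (J.map σ)ᵀ = J) (hdet : J.det ≠ 0)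
    {u u' : GL (Fin 2) k} (hu : u ∈ unitaryGroupOfForm σ J) (hu' : u' ∈ unitaryGroupOfForm σ J)
    (hnil : IsNilpotent ((u : Matrix (Fin 2) (Fin 2) k) - 1)) (hnil' : IsNilpotent ((u' : Matrix (Fin 2) (Fin 2) k) - 1)) (h1 : u ≠ 1) (h1' : u' ≠ 1) :
    ∃ g : GL (Fin 2) k, g ∈ unitaryGroupOfForm σ J ∧ g * u * g⁻¹ = u' := by
  obtain ⟨T, hT⟩ := exists_formCongr_antidiag_eq_two hk σ hσ J hJ hdet
  have hmem : ∀ {x : GL (Fin 2) k}, x ∈ unitaryGroupOfForm σ J → T * x * T⁻¹ ∈ unitaryGroupOfForm σ ((StdForm.antidiagonal 2).over k) := by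
    intro x hx; rw [conj_mem_unitaryGroupOfForm_iff, hT]; exact hx
  have hne : ∀ {x : GL (Fin 2) k}, x ≠ 1 → T * x * T⁻¹ ≠ 1 := fun {x} hx h => hx (by
    calc x = T⁻¹ * (T * x * T⁻¹) * T := by group
      _ = 1 := by rw [h]; group)
  obtain ⟨g₀, hg₀, hconj⟩ := exists_conj_eq_of_ne_one_two hk σ hσ (hmem hu) (hmem hu')
    (isNilpotent_coe_conj_sub_one T hnil) (isNilpotent_coe_conj_sub_one T hnil') (hne h1) (hne h1')
  refine ⟨T⁻¹ * g₀ * T, ?_, ?_⟩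
  · have key := (conj_mem_unitaryGroupOfForm_iff σ T ((StdForm.antidiagonal 2).over k) (T⁻¹ * g₀ * T)).1
    rw [hT] at key
    apply key
    have hg : T * (T⁻¹ * g₀ * T) * T⁻¹ = g₀ := by group
    rw [hg]; exact hg₀
  · calc T⁻¹ * g₀ * T * u * (T⁻¹ * g₀ * T)⁻¹ = T⁻¹ * (g₀ * (T * u * T⁻¹) * g₀⁻¹) * T := by group
      _ = u' := by rw [hconj]; group

/-- **Class functions of `U(σ, J)` (`2 × 2`, any non-degenerate hermitian `J` over `𝔽_{q²}`) are constant on the non-trivial unipotents** — the `χ₁`-stratum of the `H`-side `U(W)`.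
[cite: Rogawski1990, §3.9 p. 32] -/
theorem eq_of_conj_invariant_of_ne_one_two_of_hermitian (hk : Fintype.card k = q ^ 2) (σ : k →+* k) (hσ : ∀ x, σ x = x ^ q)
    {J : Matrix (Fin 2) (Fin 2) k} (hJ : (J.map σ)ᵀ = J) (hdet : J.det ≠ 0)
    {α : Type*} (f : GL (Fin 2) k → α) (hf : ∀ g ∈ unitaryGroupOfForm σ J, ∀ x ∈ unitaryGroupOfForm σ J, f (g * x * g⁻¹) = f x)
    {u u' : GL (Fin 2) k} (hu : u ∈ unitaryGroupOfForm σ J) (hu' : u' ∈ unitaryGroupOfForm σ J)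
    (hnil : IsNilpotent ((u : Matrix (Fin 2) (Fin 2) k) - 1)) (hnil' : IsNilpotent ((u' : Matrix (Fin 2) (Fin 2) k) - 1)) (h1 : u ≠ 1) (h1' : u' ≠ 1) :
    f u = f u' := by
  obtain ⟨g, hg, hconj⟩ := exists_conj_eq_of_ne_one_two_of_hermitian hk σ hσ hJ hdet hu hu' hnil hnil' h1 h1'
  rw [← hconj, hf g hg u hu]

/-! ### §3 The isotropic census of the hermitian plane `(k², J₀)` -/

omit [Fintype k] in
/-- Along `σ(T)ᵀ T = J₀` the form `B₀` becomes the standard norm: `B₀ (T⁻¹x) (T⁻¹x) = Σ σ(x_i) x_i` (`2 × 2`). [cite: Wilson2009, §3.6 (3.25) p. 66] -/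
theorem B₀_inv_mulVec_self_eq_sum_two (σ : k →+* k) {T : GL (Fin 2) k} (hT : formCongr σ T (1 : Matrix (Fin 2) (Fin 2) k) = (StdForm.antidiagonal 2).over k)
    (x : Fin 2 → k) :
    B₀ σ 2 (((T⁻¹ : GL (Fin 2) k) : Matrix (Fin 2) (Fin 2) k) *ᵥ x) (((T⁻¹ : GL (Fin 2) k) : Matrix (Fin 2) (Fin 2) k) *ᵥ x) = ∑ i, σ (x i) * x i := by
  have h1 : (((T⁻¹ : GL (Fin 2) k) : Matrix (Fin 2) (Fin 2) k).map σ)ᵀ * (StdForm.antidiagonal 2).over k * ((T⁻¹ : GL (Fin 2) k) : Matrix (Fin 2) (Fin 2) k) = 1 := by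
    have := formCongr_inv_formCongr σ T (1 : Matrix (Fin 2) (Fin 2) k)
    rw [hT] at this
    exact this
  rw [B₀_mulVec_mulVec, h1]
  refine sum_congr rfl fun a _ => ?_
  simp only [Matrix.one_apply, mul_ite, mul_one, mul_zero, sum_ite_eq, mem_univ, if_true]

/-- **`#{v ∈ k² : B₀ v v = 0} = q³ + q² − q`** (Wilson's `1 + z₂`), by transport from ★ `natCard_sphere_succ_zero`. [cite: Wilson2009, §3.6 (3.25) p. 66] -/
theorem natCard_isotropic_antidiag_two [DecidableEq k] (hk : Fintype.card k = q ^ 2) (σ : k →+* k) (hσ : ∀ x, σ x = x ^ q) :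
    (Nat.card {v : Fin 2 → k // B₀ σ 2 v v = 0} : ℤ) = (q : ℤ) ^ 3 + (q : ℤ) ^ 2 - q := by
  have hH : (((StdForm.antidiagonal 2).over k).map σ)ᵀ = (StdForm.antidiagonal 2).over k := by rw [StdForm.over_map, StdForm.transpose_over]
  have hHd : ((StdForm.antidiagonal 2).over k).det ≠ 0 := ((Matrix.isUnit_iff_isUnit_det _).1 ((StdForm.antidiagonal 2).isUnit_over k)).ne_zero
  obtain ⟨T, hT⟩ := exists_formCongr_one_eq hk σ hσ ((StdForm.antidiagonal 2).over k) hH hHd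
  have hTT : ((T⁻¹ : GL (Fin 2) k) : Matrix (Fin 2) (Fin 2) k) * (T : Matrix (Fin 2) (Fin 2) k) = 1 := by
    rw [← Units.val_mul, inv_mul_cancel, Units.val_one]
  have hTT' : (T : Matrix (Fin 2) (Fin 2) k) * ((T⁻¹ : GL (Fin 2) k) : Matrix (Fin 2) (Fin 2) k) = 1 := by
    rw [← Units.val_mul, mul_inv_cancel, Units.val_one]
  have key := B₀_inv_mulVec_self_eq_sum_two σ hT
  have e : {v : Fin 2 → k // B₀ σ 2 v v = 0} ≃ {x : Fin 2 → k // ∑ i, σ (x i) * x i = 0} :=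
    { toFun := fun v => ⟨(T : Matrix (Fin 2) (Fin 2) k) *ᵥ v.1, by
        rw [← key, Matrix.mulVec_mulVec, hTT, Matrix.one_mulVec]; exact v.2⟩
      invFun := fun x => ⟨((T⁻¹ : GL (Fin 2) k) : Matrix (Fin 2) (Fin 2) k) *ᵥ x.1, by rw [key]; exact x.2⟩
      left_inv := fun v => Subtype.ext (by simp only [Matrix.mulVec_mulVec, hTT, Matrix.one_mulVec])
      right_inv := fun x => Subtype.ext (by simp only [Matrix.mulVec_mulVec, hTT', Matrix.one_mulVec]) }
  rw [Nat.card_congr e, natCard_sphere_succ_zero hk σ hσ 1]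
  ring

/-- **`#{v ≠ 0 : B₀ v v = 0} = (q² − 1)(q + 1)`** on `k²` — Wilson's `z₂`: `q + 1` isotropic points (the valency of the rank-2 star ∕ of a type-2 vertex of the `U(3)` tree).
[cite: Wilson2009, §3.6 (3.25) p. 66] -/
theorem natCard_isotropic_ne_zero_antidiag_two [DecidableEq k] (hk : Fintype.card k = q ^ 2) (σ : k →+* k) (hσ : ∀ x, σ x = x ^ q) :
    (Nat.card {v : Fin 2 → k // v ≠ 0 ∧ B₀ σ 2 v v = 0} : ℤ) = ((q : ℤ) ^ 2 - 1) * ((q : ℤ) + 1) := by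
  have hall := natCard_isotropic_antidiag_two hk σ hσ
  have hsplit := Nat.card_congr (Equiv.sumCompl fun x : {v : Fin 2 → k // B₀ σ 2 v v = 0} => x.1 ≠ 0).symm
  rw [Nat.card_sum] at hsplit
  have hone : Nat.card {x : {v : Fin 2 → k // B₀ σ 2 v v = 0} // ¬ x.1 ≠ 0} = 1 := by
    rw [Nat.card_eq_one_iff_unique]
    exact ⟨⟨fun x y => Subtype.ext (Subtype.ext ((not_not.1 x.2).trans (not_not.1 y.2).symm))⟩, ⟨⟨⟨0, by simp⟩, by simp⟩⟩⟩
  have hne : Nat.card {x : {v : Fin 2 → k // B₀ σ 2 v v = 0} // x.1 ≠ 0} = Nat.card {v : Fin 2 → k // v ≠ 0 ∧ B₀ σ 2 v v = 0} :=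
    Nat.card_congr ((Equiv.subtypeSubtypeEquivSubtypeInter (fun v : Fin 2 → k => B₀ σ 2 v v = 0) fun v => v ≠ 0).trans
      (Equiv.subtypeEquivRight fun v => and_comm))
  have h' : (Nat.card {v : Fin 2 → k // B₀ σ 2 v v = 0} : ℤ) = Nat.card {v : Fin 2 → k // v ≠ 0 ∧ B₀ σ 2 v v = 0} + 1 := by
    rw [← hne, hsplit, hone]; push_cast; ring
  linear_combination hall - h'

end Finite

end Literature.GroupTheory.SpecificGroups
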